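import Summits.Schanuel.Schanuel.Theorems.ZilberEacGraphCurveEscapePoly
import Summits.Schanuel.Schanuel.Theorems.ZilberEacGraphCurveEdge
import HarnessLib

/-!
# Non-split surfaces over a graph base, I: the edge of `P(x; y₀, y₁)` and the escaping
# exponential points of `P(z; e^z, e^{p(z)}) = 0`

HONEST FRAMING.  Cell `pub-schanuel` (Zilber's Exponential-Algebraic Closedness, case ladder;
host summit Schanuel), seat 2, gen 16.  The surfaces of Mantova–Masser's case (dim-π-S-1-free)
over a graph base `x₁ = p(x₀)` are exactly the hypersurfaces `{x₁ = p(x₀), P(x₀; y₀, y₁) = 0}`,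
`P ∈ ℂ[x, y₀, y₁]` irreducible — in general NOT a product (the fibre curve moves with `x₀`).  This
file extends the Newton-polygon escape of `ZilberEacGraphCurveEdge` (products) to such `P`: along
the graph, `P(z; e^z, e^{p(z)}) = Σ_m c_m z^{m₀} e^{m₁ z + m₂ p(z)}` is an exponential sum with
POLYNOMIAL coefficients, and the engine `exists_escape_zeros_poly` applies when the lower-left edge
of the `y`-support is BALANCED (its top `x`-degree is attained by a monomial set whose edge
polynomial has a nonzero root — e.g. for every `P` that is `x`-equidegree on its `y`-support, in
particular for generic `P`).  Density: `ZilberEacGraphSurfaceDensity`.  Instances of an OPEN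
question (PLMS 2024, §1 p. 5); NOT Schanuel's conjecture; `EC(3,2)` stays OPEN.  The UNBALANCED
edges (a single monomial of top `x`-degree on the edge, e.g. `y₀² + y₁² = x₀ + 2`) need a
logarithmically corrected root equation `p(z) + sz − μ log z ∈ log θ + 2πiℤ` and are left open here.

Variables of `P : MvPolynomial (Fin 3) ℂ`: `0 ↦ x (= x₀)`, `1 ↦ y₀`, `2 ↦ y₁`; weight
`w(m) = m₁ − s m₂`.
-/

noncomputable section

open Filter Topology Metric Set Complex
open Literature.ModelTheory.Zilber

set_option linter.dupNamespace false

namespace Summit.Schanuel.Schanuel.Theorems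

/-! ## Part A. The lower-left edge of the `y`-support -/

/-- **A lower-left edge of the `y`-support of `P ∈ ℂ[x, y₀, y₁]`.**  If the support `A` has two
exponents with different `y₁`-degree, then for some real slope `s` and base exponent `m_b ∈ A`
the weight `w(m) = m₁ - s m₂` satisfies: `w(m_b) ≤ w(m)` on `A`; every minimiser has `y₁`-degree
`≥` that of `m_b`; some minimiser has a DIFFERENT `y₁`-degree. (new) -/
theorem exists_lowerLeft_edge₃ (A : Finset (Fin 3 →₀ ℕ))
    (h2 : ∃ m ∈ A, ∃ m' ∈ A, m 2 ≠ m' 2) :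
    ∃ (s : ℝ) (mb : Fin 3 →₀ ℕ), mb ∈ A ∧
      (∀ m ∈ A, ((mb 1 : ℝ) - s * mb 2) ≤ (m 1 : ℝ) - s * m 2) ∧
      (∀ m ∈ A, ((m 1 : ℝ) - s * m 2) = (mb 1 : ℝ) - s * mb 2 → mb 2 ≤ m 2) ∧
      (∃ m ∈ A, m 2 ≠ mb 2 ∧ ((m 1 : ℝ) - s * m 2) = (mb 1 : ℝ) - s * mb 2) := by
  classical
  obtain ⟨m₁, hm₁, m₁', hm₁', hne⟩ := h2
  have hA : A.Nonempty := ⟨m₁, hm₁⟩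
  obtain ⟨m₀, hm₀, hmin0⟩ := A.exists_min_image (fun m => m 1) hA
  set T := A.filter (fun m : Fin 3 →₀ ℕ => m 2 ≠ m₀ 2) with hT
  have hTne : T.Nonempty := by
    by_cases h : m₁ 2 = m₀ 2
    · refine ⟨m₁', Finset.mem_filter.2 ⟨hm₁', ?_⟩⟩
      rw [← h]; exact fun h' => hne h'.symm
    · exact ⟨m₁, Finset.mem_filter.2 ⟨hm₁, h⟩⟩
  obtain ⟨ms, hmsT, hmsmin⟩ := T.exists_min_image
    (fun m => ((m 1 : ℝ) - m₀ 1) / |(m 2 : ℝ) - m₀ 2|) hTne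
  have hmsA : ms ∈ A := (Finset.mem_filter.1 hmsT).1
  have hms2 : ms 2 ≠ m₀ 2 := (Finset.mem_filter.1 hmsT).2
  have hDs : ((ms 2 : ℝ) - m₀ 2) ≠ 0 := by
    intro h; apply hms2; exact_mod_cast (sub_eq_zero.1 h)
  set s : ℝ := ((ms 1 : ℝ) - m₀ 1) / ((ms 2 : ℝ) - m₀ 2) with hs_def
  have hw : ∀ m ∈ A, ((m₀ 1 : ℝ) - s * m₀ 2) ≤ (m 1 : ℝ) - s * m 2 := by
    intro m hm
    have hN : (m₀ 1 : ℝ) ≤ m 1 := by exact_mod_cast hmin0 m hm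
    by_cases h1 : m 2 = m₀ 2
    · rw [h1]; linarith
    · have hmT : m ∈ T := Finset.mem_filter.2 ⟨hm, h1⟩
      have hD : ((m 2 : ℝ) - m₀ 2) ≠ 0 := by
        intro h; apply h1; exact_mod_cast (sub_eq_zero.1 h)
      have hDpos : 0 < |(m 2 : ℝ) - m₀ 2| := abs_pos.2 hD
      have hNs : (m₀ 1 : ℝ) ≤ ms 1 := by exact_mod_cast hmin0 ms hmsA
      have hr := hmsmin m hmT
      have habs : |s| = ((ms 1 : ℝ) - m₀ 1) / |(ms 2 : ℝ) - m₀ 2| := by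
        rw [hs_def, abs_div, abs_of_nonneg (by linarith)]
      have h3 : s * ((m 2 : ℝ) - m₀ 2) ≤ (m 1 : ℝ) - m₀ 1 := by
        calc s * ((m 2 : ℝ) - m₀ 2) ≤ |s * ((m 2 : ℝ) - m₀ 2)| := le_abs_self _
          _ = ((ms 1 : ℝ) - m₀ 1) / |(ms 2 : ℝ) - m₀ 2| * |(m 2 : ℝ) - m₀ 2| := by
              rw [abs_mul, habs]
          _ ≤ ((m 1 : ℝ) - m₀ 1) / |(m 2 : ℝ) - m₀ 2| * |(m 2 : ℝ) - m₀ 2| :=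
              mul_le_mul_of_nonneg_right hr hDpos.le
          _ = (m 1 : ℝ) - m₀ 1 := div_mul_cancel₀ _ hDpos.ne'
      linarith
  have hws : ((ms 1 : ℝ) - s * ms 2) = (m₀ 1 : ℝ) - s * m₀ 2 := by
    have : s * ((ms 2 : ℝ) - m₀ 2) = (ms 1 : ℝ) - m₀ 1 := by
      rw [hs_def]; exact div_mul_cancel₀ _ hDs
    linarith
  set M := A.filter (fun m : Fin 3 →₀ ℕ => ((m 1 : ℝ) - s * m 2) = (m₀ 1 : ℝ) - s * m₀ 2) with hM
  have hm₀M : m₀ ∈ M := Finset.mem_filter.2 ⟨hm₀, rfl⟩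
  have hmsM : ms ∈ M := Finset.mem_filter.2 ⟨hmsA, hws⟩
  obtain ⟨mb, hmbM, hmbmin⟩ := M.exists_min_image (fun m => m 2) ⟨m₀, hm₀M⟩
  have hmbA : mb ∈ A := (Finset.mem_filter.1 hmbM).1
  have hwb : ((mb 1 : ℝ) - s * mb 2) = (m₀ 1 : ℝ) - s * m₀ 2 := (Finset.mem_filter.1 hmbM).2
  refine ⟨s, mb, hmbA, fun m hm => ?_, fun m hm hmw => ?_, ?_⟩
  · rw [hwb]; exact hw m hm
  · exact hmbmin m (Finset.mem_filter.2 ⟨hm, by rw [hmw, hwb]⟩)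
  · by_cases hb : ms 2 = mb 2
    · refine ⟨m₀, hm₀, ?_, by rw [hwb]⟩
      rw [← hb]; exact fun h => hms2 h.symm
    · exact ⟨ms, hmsA, hb, by rw [hws, hwb]⟩

/-- Two exponents of equal weight, equal `y₁`-degree and equal `x`-degree coincide. -/
theorem gse_eq_of_weight_eq {s : ℝ} {m m' : Fin 3 →₀ ℕ}
    (hw : ((m 1 : ℝ) - s * m 2) = (m' 1 : ℝ) - s * m' 2) (h2 : m 2 = m' 2) (h0 : m 0 = m' 0) :
    m = m' := by
  have h1 : (m 1 : ℝ) = m' 1 := by rw [h2] at hw; linarith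
  have h1' : m 1 = m' 1 := by exact_mod_cast h1
  ext i
  fin_cases i
  · exact h0
  · exact h1'
  · exact h2

/-! ## Part B. The exponential sum along the graph and its edge decomposition -/

section EdgeSum

variable (p : Polynomial ℂ) (P : MvPolynomial (Fin 3) ℂ)

/-- `P(z; e^z, e^{p(z)}) = Σ_{m ∈ supp P} c_m z^{m₀} e^{m₁ z + m₂ p(z)}`. -/
theorem eval₃_exp_eq_sum (z : ℂ) :
    MvPolynomial.eval ![z, exp z, exp (p.eval z)] P =
      ∑ m ∈ P.support, P.coeff m * z ^ (m 0) * exp ((m 1 : ℂ) * z + (m 2 : ℂ) * p.eval z) := by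
  rw [MvPolynomial.eval_eq']
  refine Finset.sum_congr rfl fun m _ => ?_
  simp only [Fin.prod_univ_three, Matrix.cons_val_zero, Matrix.cons_val_one,
    Matrix.cons_val_two, Matrix.tail_cons, Matrix.head_cons, Complex.exp_add, Complex.exp_nat_mul]
  ring

variable {p P} {s : ℝ} {mb : Fin 3 →₀ ℕ}

/-- **Edge decomposition (polynomial coefficients).**  With `R₀ = p + sX`,
`M = {m ∈ supp P : w(m) = w(m_b)}` and `(m_b)₂ ≤ m₂` on `M`:
`P(z; e^z, e^{p z}) = e^{(m_b)₁ z + (m_b)₂ p(z)} · (Σ_{m ∈ M} (c_m X^{m₀})(z) · (e^{R₀(z)})^{m₂ - (m_b)₂} + E(z))`,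
`E(z) = Σ_{m ∉ M} c_m z^{m₀} e^{(w(m)-w(m_b)) z + (m₂ - (m_b)₂) R₀(z)}`. (new) -/
theorem eval₃_exp_eq_mul_edgeSum
    (hE2 : ∀ m ∈ P.support, ((m 1 : ℝ) - s * m 2) = (mb 1 : ℝ) - s * mb 2 → mb 2 ≤ m 2)
    (z : ℂ) :
    MvPolynomial.eval ![z, exp z, exp (p.eval z)] P =
      exp ((mb 1 : ℂ) * z + (mb 2 : ℂ) * p.eval z) *
        ((∑ m ∈ P.support.filter (fun m : Fin 3 →₀ ℕ => ((m 1 : ℝ) - s * m 2) = (mb 1 : ℝ) - s * mb 2),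
            (Polynomial.C (P.coeff m) * Polynomial.X ^ (m 0)).eval z *
              exp ((p + Polynomial.C (s : ℂ) * Polynomial.X).eval z) ^ (m 2 - mb 2)) +
          ∑ m ∈ P.support.filter
              (fun m : Fin 3 →₀ ℕ => ¬ ((m 1 : ℝ) - s * m 2) = (mb 1 : ℝ) - s * mb 2),
            P.coeff m * z ^ (m 0) *
              exp ((((m 1 : ℝ) - s * m 2 - ((mb 1 : ℝ) - s * mb 2) : ℝ) : ℂ) * z +
                (((m 2 : ℝ) - mb 2 : ℝ) : ℂ) * (p + Polynomial.C (s : ℂ) * Polynomial.X).eval z)) := by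
  classical
  rw [eval₃_exp_eq_sum, mul_add, Finset.mul_sum, Finset.mul_sum,
    ← Finset.sum_filter_add_sum_filter_not P.support
      (fun m : Fin 3 →₀ ℕ => ((m 1 : ℝ) - s * m 2) = (mb 1 : ℝ) - s * mb 2)]
  have hR : (p + Polynomial.C (s : ℂ) * Polynomial.X).eval z = p.eval z + (s : ℂ) * z := by
    simp [Polynomial.eval_add, Polynomial.eval_mul]
  congr 1
  · refine Finset.sum_congr rfl fun m hm => ?_
    obtain ⟨hmA, hmw⟩ := Finset.mem_filter.1 hm
    have hle : mb 2 ≤ m 2 := hE2 m hmA hmw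
    have hwC := congrArg (fun r : ℝ => (r : ℂ)) hmw
    push_cast at hwC
    rw [Polynomial.eval_mul, Polynomial.eval_C, Polynomial.eval_pow, Polynomial.eval_X,
      ← Complex.exp_nat_mul, Nat.cast_sub hle, hR]
    rw [show exp ((mb 1 : ℂ) * z + (mb 2 : ℂ) * p.eval z) *
        (P.coeff m * z ^ (m 0) * exp (((m 2 : ℂ) - (mb 2 : ℂ)) * (p.eval z + (s : ℂ) * z))) =
        P.coeff m * z ^ (m 0) * (exp ((mb 1 : ℂ) * z + (mb 2 : ℂ) * p.eval z) *
          exp (((m 2 : ℂ) - (mb 2 : ℂ)) * (p.eval z + (s : ℂ) * z))) by ring, ← Complex.exp_add]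
    congr 2
    linear_combination z * hwC
  · refine Finset.sum_congr rfl fun m _ => ?_
    rw [hR]
    rw [show exp ((mb 1 : ℂ) * z + (mb 2 : ℂ) * p.eval z) * (P.coeff m * z ^ (m 0) *
        exp ((((m 1 : ℝ) - s * m 2 - ((mb 1 : ℝ) - s * mb 2) : ℝ) : ℂ) * z +
          (((m 2 : ℝ) - mb 2 : ℝ) : ℂ) * (p.eval z + (s : ℂ) * z))) =
        P.coeff m * z ^ (m 0) * (exp ((mb 1 : ℂ) * z + (mb 2 : ℂ) * p.eval z) *
          exp ((((m 1 : ℝ) - s * m 2 - ((mb 1 : ℝ) - s * mb 2) : ℝ) : ℂ) * z +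
            (((m 2 : ℝ) - mb 2 : ℝ) : ℂ) * (p.eval z + (s : ℂ) * z))) by ring, ← Complex.exp_add]
    congr 2
    push_cast
    ring

/-- **The off-edge part is exponentially small in the escape regime, up to a polynomial weight**:
if `δ > 0` is at most every positive weight gap and `N` bounds the `x`-degrees, then for `Re z ≤ 0`
and `|Re R₀(z)| ≤ B`,
`‖E(z)‖ ≤ (Σ_{m ∉ M} ‖c_m‖ e^{|m₂ - (m_b)₂| B}) (1 + ‖z‖)^N e^{δ Re z}`. (new) -/
theorem norm_offEdgeSum₃_le {δ B : ℝ} {N : ℕ}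
    (hδ : ∀ m ∈ P.support, ¬ ((m 1 : ℝ) - s * m 2) = (mb 1 : ℝ) - s * mb 2 →
      δ ≤ ((m 1 : ℝ) - s * m 2) - ((mb 1 : ℝ) - s * mb 2))
    (hN : ∀ m ∈ P.support, m 0 ≤ N)
    {z : ℂ} (hz : z.re ≤ 0)
    (hB : |((p + Polynomial.C (s : ℂ) * Polynomial.X).eval z).re| ≤ B) :
    ‖∑ m ∈ P.support.filter
          (fun m : Fin 3 →₀ ℕ => ¬ ((m 1 : ℝ) - s * m 2) = (mb 1 : ℝ) - s * mb 2),
        P.coeff m * z ^ (m 0) *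
          exp ((((m 1 : ℝ) - s * m 2 - ((mb 1 : ℝ) - s * mb 2) : ℝ) : ℂ) * z +
            (((m 2 : ℝ) - mb 2 : ℝ) : ℂ) * (p + Polynomial.C (s : ℂ) * Polynomial.X).eval z)‖ ≤
      (∑ m ∈ P.support.filter
          (fun m : Fin 3 →₀ ℕ => ¬ ((m 1 : ℝ) - s * m 2) = (mb 1 : ℝ) - s * mb 2),
          ‖P.coeff m‖ * Real.exp (|(m 2 : ℝ) - mb 2| * B)) * (1 + ‖z‖) ^ N * Real.exp (δ * z.re) := by
  classical
  rw [Finset.sum_mul, Finset.sum_mul]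
  refine (norm_sum_le _ _).trans (Finset.sum_le_sum fun m hm => ?_)
  obtain ⟨hmA, hmw⟩ := Finset.mem_filter.1 hm
  rw [norm_mul, norm_mul, norm_pow, Complex.norm_exp, Complex.add_re, Complex.re_ofReal_mul,
    Complex.re_ofReal_mul]
  have h1 : ((m 1 : ℝ) - s * m 2 - ((mb 1 : ℝ) - s * mb 2)) * z.re ≤ δ * z.re :=
    mul_le_mul_of_nonpos_right (hδ m hmA hmw) hz
  have h2 : ((m 2 : ℝ) - mb 2) * ((p + Polynomial.C (s : ℂ) * Polynomial.X).eval z).re ≤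
      |(m 2 : ℝ) - mb 2| * B := by
    refine (le_abs_self _).trans ?_
    rw [abs_mul]
    exact mul_le_mul_of_nonneg_left hB (abs_nonneg _)
  have hzN : ‖z‖ ^ (m 0) ≤ (1 + ‖z‖) ^ N :=
    (pow_le_pow_left₀ (norm_nonneg _) (by linarith [norm_nonneg z]) _).trans
      (pow_le_pow_right₀ (by linarith [norm_nonneg z]) (hN m hmA))
  have hexp : Real.exp (((m 1 : ℝ) - s * m 2 - ((mb 1 : ℝ) - s * mb 2)) * z.re +
      ((m 2 : ℝ) - mb 2) * ((p + Polynomial.C (s : ℂ) * Polynomial.X).eval z).re) ≤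
      Real.exp (|(m 2 : ℝ) - mb 2| * B) * Real.exp (δ * z.re) := by
    rw [← Real.exp_add]; exact Real.exp_le_exp.2 (by linarith)
  calc ‖P.coeff m‖ * ‖z‖ ^ (m 0) * Real.exp (((m 1 : ℝ) - s * m 2 - ((mb 1 : ℝ) - s * mb 2)) * z.re +
        ((m 2 : ℝ) - mb 2) * ((p + Polynomial.C (s : ℂ) * Polynomial.X).eval z).re)
      ≤ ‖P.coeff m‖ * (1 + ‖z‖) ^ N * (Real.exp (|(m 2 : ℝ) - mb 2| * B) * Real.exp (δ * z.re)) :=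
        mul_le_mul (mul_le_mul_of_nonneg_left hzN (norm_nonneg _)) hexp (Real.exp_nonneg _)
          (by positivity)
    _ = ‖P.coeff m‖ * Real.exp (|(m 2 : ℝ) - mb 2| * B) * (1 + ‖z‖) ^ N * Real.exp (δ * z.re) := by
        ring

/-- The off-edge part is entire. -/
theorem differentiable_offEdgeSum₃ :
    Differentiable ℂ fun z : ℂ =>
      ∑ m ∈ P.support.filter
          (fun m : Fin 3 →₀ ℕ => ¬ ((m 1 : ℝ) - s * m 2) = (mb 1 : ℝ) - s * mb 2),
        P.coeff m * z ^ (m 0) *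
          exp ((((m 1 : ℝ) - s * m 2 - ((mb 1 : ℝ) - s * mb 2) : ℝ) : ℂ) * z +
            (((m 2 : ℝ) - mb 2 : ℝ) : ℂ) * (p + Polynomial.C (s : ℂ) * Polynomial.X).eval z) := by
  refine Differentiable.fun_sum fun m _ => ?_
  refine ((differentiable_const _).mul (differentiable_id.pow _)).mul ?_
  refine (((differentiable_const _).mul differentiable_id).add
    ((differentiable_const _).mul (Polynomial.differentiable _))).cexp

end EdgeSum

/-! ## Part C. Escaping exponential points (balanced edge) -/

/-- **Escaping zeros of `P(z; e^z, e^{p(z)})` for a balanced edge.**  Let `deg p ≥ 2`, and let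
`(s, m_b)` be lower-left edge data of the `y`-support of `P` (weight `w(m) = m₁ - s m₂` minimal at
`m_b`, `(m_b)₂ ≤ m₂` on the minimisers `M`).  Let `n` bound the `x`-degrees on `M` and suppose the
top polynomial `Σ_{m ∈ M, m₀ = n} c_m X^{m₂ - (m_b)₂}` is nonzero with a root `θ ≠ 0`.  Then there
are `z_k` with `P(z_k; e^{z_k}, e^{p(z_k)}) = 0` and `|Re z_k|/log(2 + ‖z_k‖) → ∞`. (new) -/
theorem exists_graphSurface_expPoints_of_edge (p : Polynomial ℂ) (hd : 2 ≤ p.natDegree)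
    (P : MvPolynomial (Fin 3) ℂ) {s : ℝ} {mb : Fin 3 →₀ ℕ}
    (hE1 : ∀ m ∈ P.support, ((mb 1 : ℝ) - s * mb 2) ≤ (m 1 : ℝ) - s * m 2)
    (hE2 : ∀ m ∈ P.support, ((m 1 : ℝ) - s * m 2) = (mb 1 : ℝ) - s * mb 2 → mb 2 ≤ m 2)
    (n : ℕ)
    (hn : ∀ m ∈ P.support, ((m 1 : ℝ) - s * m 2) = (mb 1 : ℝ) - s * mb 2 → m 0 ≤ n)
    {θ : ℂ} (hθ0 : θ ≠ 0)
    (hθ : (∑ m ∈ P.support.filter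
        (fun m : Fin 3 →₀ ℕ => ((m 1 : ℝ) - s * m 2) = (mb 1 : ℝ) - s * mb 2),
        Polynomial.C ((Polynomial.C (P.coeff m) * Polynomial.X ^ (m 0)).coeff n) *
          Polynomial.X ^ (m 2 - mb 2)).eval θ = 0)
    (hQ : (∑ m ∈ P.support.filter
        (fun m : Fin 3 →₀ ℕ => ((m 1 : ℝ) - s * m 2) = (mb 1 : ℝ) - s * mb 2),
        Polynomial.C ((Polynomial.C (P.coeff m) * Polynomial.X ^ (m 0)).coeff n) *
          Polynomial.X ^ (m 2 - mb 2)) ≠ 0) :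
    ∃ z : ℕ → ℂ, (∀ k, MvPolynomial.eval ![z k, exp (z k), exp (p.eval (z k))] P = 0) ∧
      Tendsto (fun k => |(z k).re| / Real.log (2 + ‖z k‖)) atTop atTop := by
  classical
  set R₀ : Polynomial ℂ := p + Polynomial.C (s : ℂ) * Polynomial.X with hR₀
  have hdeg : R₀.natDegree = p.natDegree := by
    rw [hR₀]
    apply Polynomial.natDegree_add_eq_left_of_natDegree_lt
    calc (Polynomial.C (s : ℂ) * Polynomial.X).natDegree ≤ Polynomial.X.natDegree :=
          Polynomial.natDegree_C_mul_le _ _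
      _ ≤ 1 := Polynomial.natDegree_X_le
      _ < p.natDegree := by omega
  have hdR : 2 ≤ R₀.natDegree := by rw [hdeg]; exact hd
  set M := P.support.filter
    (fun m : Fin 3 →₀ ℕ => ((m 1 : ℝ) - s * m 2) = (mb 1 : ℝ) - s * mb 2) with hM
  set Nf := P.support.filter
    (fun m : Fin 3 →₀ ℕ => ¬ ((m 1 : ℝ) - s * m 2) = (mb 1 : ℝ) - s * mb 2) with hNf
  -- the weight gap `δ` and the `x`-degree bound `N`
  obtain ⟨δ, hδpos, hδ⟩ : ∃ δ : ℝ, 0 < δ ∧ ∀ m ∈ P.support,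
      ¬ ((m 1 : ℝ) - s * m 2) = (mb 1 : ℝ) - s * mb 2 →
        δ ≤ ((m 1 : ℝ) - s * m 2) - ((mb 1 : ℝ) - s * mb 2) := by
    by_cases hNe : Nf.Nonempty
    · obtain ⟨mm, hmm, hmmmin⟩ := Nf.exists_min_image
        (fun m => ((m 1 : ℝ) - s * m 2) - ((mb 1 : ℝ) - s * mb 2)) hNe
      obtain ⟨hmmA, hmmw⟩ := Finset.mem_filter.1 hmm
      refine ⟨((mm 1 : ℝ) - s * mm 2) - ((mb 1 : ℝ) - s * mb 2), ?_, fun m hm hmw =>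
        hmmmin m (Finset.mem_filter.2 ⟨hm, hmw⟩)⟩
      have := hE1 mm hmmA
      rcases this.lt_or_eq with h | h
      · linarith
      · exact absurd h.symm hmmw
    · refine ⟨1, zero_lt_one, fun m hm hmw => ?_⟩
      exact absurd ⟨m, Finset.mem_filter.2 ⟨hm, hmw⟩⟩ hNe
  set N : ℕ := P.support.sup (fun m => m 0) with hNdef
  have hN : ∀ m ∈ P.support, m 0 ≤ N := fun m hm => Finset.le_sup (f := fun m => m 0) hm
  -- the off-edge part
  set E : ℂ → ℂ := fun z => ∑ m ∈ Nf, P.coeff m * z ^ (m 0) *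
    exp ((((m 1 : ℝ) - s * m 2 - ((mb 1 : ℝ) - s * mb 2) : ℝ) : ℂ) * z +
      (((m 2 : ℝ) - mb 2 : ℝ) : ℂ) * R₀.eval z) with hEdef
  have hEdiff : Differentiable ℂ E := differentiable_offEdgeSum₃
  have hEb : ∀ B : ℝ, ∃ C : ℝ, 0 ≤ C ∧ ∃ N' : ℕ,
      ∀ z : ℂ, z.re ≤ 0 → |(R₀.eval z).re| ≤ B →
        ‖E z‖ ≤ C * (1 + ‖z‖) ^ N' * Real.exp (δ * z.re) := by
    intro B
    refine ⟨∑ m ∈ Nf, ‖P.coeff m‖ * Real.exp (|(m 2 : ℝ) - mb 2| * B),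
      Finset.sum_nonneg fun m _ => by positivity, N, fun z hz hzB => ?_⟩
    exact norm_offEdgeSum₃_le hδ hN hz hzB
  -- the engine with polynomial coefficients
  obtain ⟨z, L, hL, hz⟩ := exists_escape_zeros_poly R₀ hdR M
    (fun m => Polynomial.C (P.coeff m) * Polynomial.X ^ (m 0)) (fun m => m 2 - mb 2) n
    (fun m hm => by
      obtain ⟨hmA, hmw⟩ := Finset.mem_filter.1 hm
      exact (Polynomial.natDegree_C_mul_le _ _).trans
        ((Polynomial.natDegree_pow_le).trans (by simpa using hn m hmA hmw)))
    hθ0 hθ hQ E hEdiff hδpos hEb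
  refine ⟨z, fun k => ?_, tendsto_abs_re_div_log_of_linear hL (fun k => (hz k).2.1)
    (fun k => (hz k).2.2)⟩
  rw [eval₃_exp_eq_mul_edgeSum hE2 (z k)]
  have h := (hz k).1
  rw [hEdef] at h
  rw [h, mul_zero]

end Summit.Schanuel.Schanuel.Theorems
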